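import Mathlib
import Summits.MatrixMultiplication.MatrixMultiplication.Theses.ThinBlockAlpha

/-!
Candidate proof (drefute seat) of the lead's `stub_chartSTPP` (CKSU 2005 Thm 37 in the tree's `IsSTPP`
conventions), against VERBATIM copies of the skeleton's definitions `ChartSolvable`, `SymbolTPP`,
`IsLocalChartUSP` (file `Cruxes/RectangularThmB/Lines/refutation-null-chart-9.lean`).  The proof body of
`chartSTPP` can be pasted under `stub_chartSTPP` unchanged.
-/

open Literature.Computability.AlgebraicComplexity

namespace DrefuteChart

def ChartSolvable {H₀ Γ : Type} [AddCommGroup H₀] (A B C : Γ → Finset H₀) (x y z : Γ) : Prop :=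
  ∃ s ∈ A z, ∃ s' ∈ A x, ∃ t ∈ B x, ∃ t' ∈ B y, ∃ u ∈ C y, ∃ u' ∈ C z,
    (s' - s) + (t' - t) + (u' - u) = 0

def SymbolTPP {H₀ : Type} [AddCommGroup H₀] (A B C : Finset H₀) : Prop :=
  ∀ s ∈ A, ∀ s' ∈ A, ∀ t ∈ B, ∀ t' ∈ B, ∀ u ∈ C, ∀ u' ∈ C,
    (s' - s) + (t' - t) + (u' - u) = 0 → s = s' ∧ t = t' ∧ u = u'

def IsLocalChartUSP {H₀ Γ : Type} [AddCommGroup H₀] (A B C : Γ → Finset H₀) {n L : ℕ}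
    (row : Fin L → Fin n → Γ) : Prop :=
  ∀ i j k : Fin L, (i ≠ j ∨ j ≠ k) → ∃ c : Fin n, ¬ ChartSolvable A B C (row i c) (row j c) (row k c)

theorem chartSTPP : ∀ (H₀ Γ : Type) [AddCommGroup H₀] [DecidableEq H₀]
    (A B C : Γ → Finset H₀), (∀ x, SymbolTPP (A x) (B x) (C x)) →
    ∀ (n L : ℕ) (row : Fin L → Fin n → Γ), IsLocalChartUSP A B C row →
      IsSTPP (fun i => Fintype.piFinset fun c => A (row i c))
        (fun i => Fintype.piFinset fun c => B (row i c))
        (fun i => Fintype.piFinset fun c => C (row i c)) := by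
  intro H₀ Γ _ _ A B C hTPP n L row hUSP i j k s hs s' hs' t ht t' ht' u hu u' hu' hrel
  simp only [Fintype.mem_piFinset] at hs hs' ht ht' hu hu'
  -- the relation, coordinate by coordinate
  have hc : ∀ c, (s' c - s c) + (t' c - t c) + (u' c - u c) = 0 := fun c => by
    have h := congrFun hrel c
    simpa using h
  -- every coordinate pattern is solvable
  have hsolv : ∀ c, ChartSolvable A B C (row i c) (row j c) (row k c) := fun c =>
    ⟨s c, hs c, s' c, hs' c, t c, ht c, t' c, ht' c, u c, hu c, u' c, hu' c, hc c⟩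
  -- hence the indices coincide
  have hijk : i = j ∧ j = k := by
    by_contra hne
    have hne' : i ≠ j ∨ j ≠ k := by tauto
    obtain ⟨c, hc'⟩ := hUSP i j k hne'
    exact hc' (hsolv c)
  obtain ⟨rfl, rfl⟩ := hijk
  -- and the per-symbol TPP finishes
  refine ⟨rfl, rfl, ?_, ?_, ?_⟩
  · funext c
    exact (hTPP (row i c) (s c) (hs c) (s' c) (hs' c) (t c) (ht c) (t' c) (ht' c) (u c) (hu c)
      (u' c) (hu' c) (hc c)).1
  · funext c
    exact (hTPP (row i c) (s c) (hs c) (s' c) (hs' c) (t c) (ht c) (t' c) (ht' c) (u c) (hu c)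
      (u' c) (hu' c) (hc c)).2.1
  · funext c
    exact (hTPP (row i c) (s c) (hs c) (s' c) (hs' c) (t c) (ht c) (t' c) (ht' c) (u c) (hu c)
      (u' c) (hu' c) (hc c)).2.2

end DrefuteChart
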